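import Literature.NumberTheory.Sieve.LargestPrimeFactorCubicMertensG
import Literature.NumberTheory.Sieve.LargestPrimeFactorCubicKProduct
import Literature.NumberTheory.LFunctions.MertensSecondExpSqrt
import HarnessLib

/-!
# Heath-Brown 2001 (PLMS): the Mertens windows `(6.3)` (`log 4/3`) and `L(δ)` of Lemma 8

Topic `Literature/NumberTheory/Sieve`; a PROVED analytic layer (no named facts) under the named facts
`Irving2015_largestPrimeFactor_cubic` / `HeathBrown2001_largestPrimeFactor_cubic`
(`LargestPrimeFactorCubic.lean`), continuing `…KProduct.lean` (`∏ k(p) ≥ 0.91`) and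
`…MertensG.lean` (Lemma 9): the two remaining ANALYTIC constants of the main term `S₀ ≥ C₂C₃L(δ)`,
both instances of Mertens' second theorem for `g(p) = #{P : N(P) = p}` over `K = ℚ(∛2)`
(D. R. Heath-Brown, *The largest prime factor of `X³ + 2`*, Proc. London Math. Soc. (3) 82 (2001)
554–596; pages of the held text `paper:heathbrown2001-largest-prime-factor-i-x-i-sup`):

* §6, display **(6.3)** (p. 22): "`∑_{K ∈ 𝒦} ρ(K)/N(K) = ∑_{X^{3δ} < p ≤ X^{4δ}} g(p)/p` … By the Prime
  Ideal Theorem … `= log log X^{4δ} − log log X^{3δ} + o(1) = log(4/3) + o(1)`" — the `log 4/3` of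
  Lemma 6 and of `C₂`;
* §8 (p. 31): "`∑_{p ≤ x} ν(p)/p = log log x + C + o(1)` … whence
  `∑_{q₁,q₂} ν(q₁)ν(q₂)/(q₁q₂) = L(δ) + o(1)`", `ν(p) = g(p)/(1 + p⁻¹)` (p. 11), the sum over primes
  `N^{5/7} < q₁ ≤ N^{5/7+δ}`, `N^{6/7} < q₂ ≤ N^{6/7+δ}` ((2.17), p. 10), and
  `L(δ) = (log(1 + 7δ/5))(log(1 + 7δ/6))` (Lemma 8, p. 11).

## What is proved (namespace `Literature.NumberTheory.Sieve.HeathBrown2001`)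

* `exists_abs_sum_g_div_sub_le` — Mertens II for `g`: `∑_{p ≤ x} g(p)/p = log log x + c + O(1/log x)`
  (the tree's `LFunctions.NumberField.sum_primesLE_idealNormCount_div_eq` for `K`, with
  `idealNormCount K p = g(p)` at primes, `CubicSieve.singularFactor_bounds`);
* **`abs_sum_g_window_sub_log_le`**, **`tendsto_sum_g_window`** — for `0 < α < β`:
  `∑_{x^α < p ≤ x^β} g(p)/p → log(β/α)` (rate `2C/(α log x)`); `tendsto_sum_g_window_63` — (6.3);
* `sum_nu_window_bounds`, **`tendsto_sum_nu_window`** — the same for `ν(p)/p = g(p)/(p+1)`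
  (`0 ≤ ∑ g/p − ∑ g/(p+1) ≤ 3/⌊x^α⌋`);
* **`tendsto_L`** — `(∑_{q₁} ν(q₁)/q₁)(∑_{q₂} ν(q₂)/q₂) → L(δ)` as `N → ∞`, for every `δ > 0`.

## References

* D. R. Heath-Brown, *The largest prime factor of `X³ + 2`*, Proc. London Math. Soc. (3) 82 (2001)
  554–596, doi:10.1112/plms/82.3.554: (6.3) p. 22, §8 p. 31, Lemma 8 p. 11, (2.17) p. 10.
  [`HeathBrown2001LargestPrimeFactorCubic`]

## Mathlib / tree search

Tree: `LFunctions.NumberField.sum_primesLE_idealNormCount_div_eq` (`DegreeOnePrimesPNT`),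
`CubicSieve.singularFactor_bounds` (`idealNormCount K p = cubeRootTwoCount p`),
`HeathBrown2001.sum_Ioc_inv_sq_le` (`…KProduct`), `CubicPrimes.cubeRootTwoCount_le_three`.
Mathlib: `Nat.primesLE`, `Nat.le_floor_iff`, `Real.log_rpow`, `tendsto_rpow_atTop`,
`squeeze_zero'`. `lean search 'sum_g_window|tendsto_L\b|nuWindow'`: no prior hits.
-/

noncomputable section

open Finset Filter Topology

namespace Literature.NumberTheory.Sieve.HeathBrown2001

open CubicPrimes (cubeRootTwoCount cubeRootTwoCount_le_three)
open CubicSieve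
open LFunctions.CubeRootTwoField (K)
open Literature.NumberTheory.LFunctions (idealNormCount)

/-! ### Mertens' second theorem for `g` and window sums -/

/-- **Mertens II for `g(p) = #{P : N(P) = p}`**: `|∑_{p ≤ x} g(p)/p − (log log x + c)| ≤ C/log x`
for `x ≥ 2`. [cite: HeathBrown2001LargestPrimeFactorCubic, §8 p. 31 ("∑_{p≤x} ν(p)/p = log log x + C + o(1) … by the Prime Ideal Theorem")] -/
theorem exists_abs_sum_g_div_sub_le :
    ∃ c C : ℝ, ∀ x : ℝ, 2 ≤ x →
      |∑ p ∈ Nat.primesLE ⌊x⌋₊, (cubeRootTwoCount p : ℝ) / p - (Real.log (Real.log x) + c)| ≤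
        C / Real.log x := by
  obtain ⟨c, C, h⟩ := Literature.NumberTheory.LFunctions.NumberField.sum_primesLE_idealNormCount_div_eq K 0
  refine ⟨c, C, fun x hx => ?_⟩
  have h1 := h x hx
  rw [zero_add, pow_one] at h1
  have hsum : ∑ p ∈ Nat.primesLE ⌊x⌋₊, (idealNormCount K p : ℝ) / p =
      ∑ p ∈ Nat.primesLE ⌊x⌋₊, (cubeRootTwoCount p : ℝ) / p := by
    refine sum_congr rfl fun p hp => ?_
    rw [(singularFactor_bounds (Nat.prime_of_mem_primesLE hp)).2]
  rwa [hsum] at h1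

/-- **The window `∑_{x^α < p ≤ x^β} g(p)/p = log(β/α) + O(1/log x)`** (`0 < α < β`, `x^α ≥ 2`):
the shape of (6.3). [cite: HeathBrown2001LargestPrimeFactorCubic, (6.3) p. 22] -/
theorem abs_sum_g_window_sub_log_le {c C : ℝ}
    (hM : ∀ x : ℝ, 2 ≤ x →
      |∑ p ∈ Nat.primesLE ⌊x⌋₊, (cubeRootTwoCount p : ℝ) / p - (Real.log (Real.log x) + c)| ≤
        C / Real.log x)
    {α β : ℝ} (hα : 0 < α) (hαβ : α < β) {x : ℝ} (hx : 2 ≤ x ^ α) (hx1 : 1 < x) :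
    |∑ p ∈ (Nat.primesLE ⌊x ^ β⌋₊).filter (fun p : ℕ => x ^ α < (p : ℝ)),
        (cubeRootTwoCount p : ℝ) / p - Real.log (β / α)| ≤ 2 * C / (α * Real.log x) := by
  have hx0 : 0 < x := by linarith
  have hlogx : 0 < Real.log x := Real.log_pos hx1
  have hαβ' : x ^ α ≤ x ^ β := Real.rpow_le_rpow_of_exponent_le hx1.le hαβ.le
  have hxβ : 2 ≤ x ^ β := hx.trans hαβ'
  rw [LFunctions.Mertens.sum_primesLE_filter_lt_eq_sub _ (by linarith) hαβ']
  have h1 := hM (x ^ α) hx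
  have h2 := hM (x ^ β) hxβ
  rw [Real.log_rpow hx0, Real.log_mul hα.ne' hlogx.ne'] at h1
  rw [Real.log_rpow hx0, Real.log_mul (by linarith : β ≠ 0) hlogx.ne'] at h2
  have hC0 : 0 ≤ C := by
    have := (abs_nonneg _).trans h1
    have hpos : 0 < α * Real.log x := by positivity
    by_contra hneg
    have : C / (α * Real.log x) < 0 := div_neg_of_neg_of_pos (lt_of_not_ge hneg) hpos
    linarith
  have hCb : C / (β * Real.log x) ≤ C / (α * Real.log x) :=
    div_le_div_of_nonneg_left hC0 (by positivity) (by nlinarith)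
  rw [Real.log_div (by linarith) hα.ne']
  rw [abs_le] at h1 h2 ⊢
  have e : 2 * C / (α * Real.log x) = C / (α * Real.log x) + C / (α * Real.log x) := by ring
  constructor <;> nlinarith [h1.1, h1.2, h2.1, h2.2]

/-- **`∑_{x^α < p ≤ x^β} g(p)/p → log(β/α)`** as `x → ∞`, for `0 < α < β`.
[cite: HeathBrown2001LargestPrimeFactorCubic, (6.3) p. 22] -/
theorem tendsto_sum_g_window {α β : ℝ} (hα : 0 < α) (hαβ : α < β) :
    Tendsto (fun x : ℝ => ∑ p ∈ (Nat.primesLE ⌊x ^ β⌋₊).filter (fun p : ℕ => x ^ α < (p : ℝ)),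
      (cubeRootTwoCount p : ℝ) / p) atTop (𝓝 (Real.log (β / α))) := by
  obtain ⟨c, C, hM⟩ := exists_abs_sum_g_div_sub_le
  have hb : Tendsto (fun x : ℝ => 2 * C / (α * Real.log x)) atTop (𝓝 0) := by
    have h := (tendsto_const_nhds (x := 2 * C / α)).div_atTop Real.tendsto_log_atTop
    refine h.congr fun x => ?_
    field_simp
  have hev : ∀ᶠ x : ℝ in atTop, 2 ≤ x ^ α := by
    have := (tendsto_rpow_atTop hα).eventually_ge_atTop 2
    exact this
  have h0 : Tendsto (fun x : ℝ => ∑ p ∈ (Nat.primesLE ⌊x ^ β⌋₊).filter (fun p : ℕ => x ^ α < (p : ℝ)),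
      (cubeRootTwoCount p : ℝ) / p - Real.log (β / α)) atTop (𝓝 0) := by
    refine squeeze_zero_norm' ?_ hb
    filter_upwards [hev, eventually_gt_atTop (1 : ℝ)] with x hx hx1
    rw [Real.norm_eq_abs]
    exact abs_sum_g_window_sub_log_le hM hα hαβ hx hx1
  have h1 := h0.add_const (Real.log (β / α))
  simp only [sub_add_cancel, zero_add] at h1
  exact h1

/-- **(6.3)**: `∑_{X^{3δ} < p ≤ X^{4δ}} g(p)/p → log(4/3)` (`δ > 0`).
[cite: HeathBrown2001LargestPrimeFactorCubic, (6.3) p. 22] -/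
theorem tendsto_sum_g_window_63 {δ : ℝ} (hδ : 0 < δ) :
    Tendsto (fun X : ℝ => ∑ p ∈ (Nat.primesLE ⌊X ^ (4 * δ)⌋₊).filter (fun p : ℕ => X ^ (3 * δ) < (p : ℝ)),
      (cubeRootTwoCount p : ℝ) / p) atTop (𝓝 (Real.log (4 / 3))) := by
  have h := tendsto_sum_g_window (α := 3 * δ) (β := 4 * δ) (by linarith) (by linarith)
  rwa [show (4 * δ) / (3 * δ) = 4 / 3 by field_simp] at h

/-! ### The same windows for `ν(p)/p = g(p)/(p + 1)` and the constant `L(δ)` -/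

/-- `0 ≤ ∑ g(p)/p − ∑ g(p)/(p+1) ≤ 3/⌊x^α⌋₊` over the window `x^α < p ≤ x^β` (`x^α ≥ 1`):
`g(p)/p − g(p)/(p+1) = g(p)/(p(p+1)) ≤ 3/p²` and `∑_{n > k} n⁻² ≤ 1/k`. [folklore] -/
theorem sum_nu_window_bounds {α β x : ℝ} (hx : 1 ≤ x ^ α) :
    0 ≤ ∑ p ∈ (Nat.primesLE ⌊x ^ β⌋₊).filter (fun p : ℕ => x ^ α < (p : ℝ)),
        ((cubeRootTwoCount p : ℝ) / p - (cubeRootTwoCount p : ℝ) / (p + 1)) ∧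
    ∑ p ∈ (Nat.primesLE ⌊x ^ β⌋₊).filter (fun p : ℕ => x ^ α < (p : ℝ)),
        ((cubeRootTwoCount p : ℝ) / p - (cubeRootTwoCount p : ℝ) / (p + 1)) ≤ 3 / (⌊x ^ α⌋₊ : ℝ) := by
  set S := (Nat.primesLE ⌊x ^ β⌋₊).filter (fun p : ℕ => x ^ α < (p : ℝ)) with hS
  have hk : 1 ≤ ⌊x ^ α⌋₊ := Nat.le_floor (by exact_mod_cast hx)
  have hmem : ∀ p ∈ S, p.Prime ∧ ⌊x ^ α⌋₊ < p ∧ p ≤ ⌊x ^ β⌋₊ := by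
    intro p hp
    rw [hS, mem_filter, Nat.mem_primesLE] at hp
    refine ⟨hp.1.2, ?_, hp.1.1⟩
    exact (Nat.floor_lt (by linarith)).mpr hp.2
  have hterm : ∀ p ∈ S, 0 ≤ (cubeRootTwoCount p : ℝ) / p - (cubeRootTwoCount p : ℝ) / (p + 1) ∧
      (cubeRootTwoCount p : ℝ) / p - (cubeRootTwoCount p : ℝ) / (p + 1) ≤ 3 * (1 / (p : ℝ) ^ 2) := by
    intro p hp
    obtain ⟨hpr, -, -⟩ := hmem p hp
    have hp0 : (0 : ℝ) < p := by exact_mod_cast hpr.pos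
    have hg0 : (0 : ℝ) ≤ cubeRootTwoCount p := Nat.cast_nonneg _
    have hg3 : (cubeRootTwoCount p : ℝ) ≤ 3 := by exact_mod_cast cubeRootTwoCount_le_three hpr
    have heq : (cubeRootTwoCount p : ℝ) / p - (cubeRootTwoCount p : ℝ) / (p + 1) =
        (cubeRootTwoCount p : ℝ) / (p * (p + 1)) := by field_simp; ring
    rw [heq]
    refine ⟨by positivity, ?_⟩
    rw [div_le_iff₀ (by positivity)]
    have : 3 * (1 / (p : ℝ) ^ 2) * (p * (p + 1)) = 3 * ((p + 1) / p) := by field_simp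
    rw [this]
    have h1 : (1 : ℝ) ≤ (p + 1) / p := by rw [le_div_iff₀ hp0]; linarith
    nlinarith
  refine ⟨sum_nonneg fun p hp => (hterm p hp).1, ?_⟩
  calc ∑ p ∈ S, ((cubeRootTwoCount p : ℝ) / p - (cubeRootTwoCount p : ℝ) / (p + 1))
      ≤ ∑ p ∈ S, 3 * (1 / (p : ℝ) ^ 2) := sum_le_sum fun p hp => (hterm p hp).2
    _ ≤ ∑ n ∈ Ioc ⌊x ^ α⌋₊ ⌊x ^ β⌋₊, 3 * (1 / (n : ℝ) ^ 2) := by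
        refine sum_le_sum_of_subset_of_nonneg (fun p hp => ?_) (fun n _ _ => by positivity)
        obtain ⟨-, h1, h2⟩ := hmem p hp
        exact mem_Ioc.mpr ⟨h1, h2⟩
    _ = 3 * ∑ n ∈ Ioc ⌊x ^ α⌋₊ ⌊x ^ β⌋₊, 1 / (n : ℝ) ^ 2 := by rw [mul_sum]
    _ ≤ 3 * (1 / (⌊x ^ α⌋₊ : ℝ)) := by
        refine mul_le_mul_of_nonneg_left (sum_Ioc_inv_sq_le hk _) (by norm_num)
    _ = 3 / (⌊x ^ α⌋₊ : ℝ) := by ring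

/-- **`∑_{x^α < p ≤ x^β} ν(p)/p → log(β/α)`**, `ν(p)/p = g(p)/(p+1)` (`0 < α < β`).
[cite: HeathBrown2001LargestPrimeFactorCubic, §8 p. 31] -/
theorem tendsto_sum_nu_window {α β : ℝ} (hα : 0 < α) (hαβ : α < β) :
    Tendsto (fun x : ℝ => ∑ p ∈ (Nat.primesLE ⌊x ^ β⌋₊).filter (fun p : ℕ => x ^ α < (p : ℝ)),
      (cubeRootTwoCount p : ℝ) / (p + 1)) atTop (𝓝 (Real.log (β / α))) := by
  have hg := tendsto_sum_g_window hα hαβ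
  -- the difference tends to `0`
  have hfloor : Tendsto (fun x : ℝ => (⌊x ^ α⌋₊ : ℝ)) atTop atTop :=
    tendsto_natCast_atTop_atTop.comp (tendsto_nat_floor_atTop.comp (tendsto_rpow_atTop hα))
  have h3 : Tendsto (fun x : ℝ => 3 / (⌊x ^ α⌋₊ : ℝ)) atTop (𝓝 0) :=
    tendsto_const_nhds.div_atTop hfloor
  have hev : ∀ᶠ x : ℝ in atTop, 1 ≤ x ^ α := (tendsto_rpow_atTop hα).eventually_ge_atTop 1
  have hdiff : Tendsto (fun x : ℝ => ∑ p ∈ (Nat.primesLE ⌊x ^ β⌋₊).filter (fun p : ℕ => x ^ α < (p : ℝ)),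
      ((cubeRootTwoCount p : ℝ) / p - (cubeRootTwoCount p : ℝ) / (p + 1))) atTop (𝓝 0) := by
    refine squeeze_zero' ?_ ?_ h3
    · filter_upwards [hev] with x hx using (sum_nu_window_bounds (β := β) hx).1
    · filter_upwards [hev] with x hx using (sum_nu_window_bounds (β := β) hx).2
  have h := hg.sub hdiff
  rw [sub_zero] at h
  refine h.congr fun x => ?_
  rw [← sum_sub_distrib]
  refine sum_congr rfl fun p _ => ?_
  ring

/-- **The constant `L(δ)`** (Lemma 8): with `ν(p)/p = g(p)/(p+1)` and the ranges (2.17),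
`(∑_{N^{5/7} < q₁ ≤ N^{5/7+δ}} ν(q₁)/q₁)(∑_{N^{6/7} < q₂ ≤ N^{6/7+δ}} ν(q₂)/q₂) →
L(δ) = log(1 + 7δ/5) log(1 + 7δ/6)` as `N → ∞` (`δ > 0`).
[cite: HeathBrown2001LargestPrimeFactorCubic, Lemma 8 (p. 11) and §8 p. 31] -/
theorem tendsto_L {δ : ℝ} (hδ : 0 < δ) :
    Tendsto (fun N : ℝ =>
      (∑ q ∈ (Nat.primesLE ⌊N ^ (5 / 7 + δ)⌋₊).filter (fun q : ℕ => N ^ (5 / 7 : ℝ) < (q : ℝ)),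
          (cubeRootTwoCount q : ℝ) / (q + 1)) *
        ∑ q ∈ (Nat.primesLE ⌊N ^ (6 / 7 + δ)⌋₊).filter (fun q : ℕ => N ^ (6 / 7 : ℝ) < (q : ℝ)),
          (cubeRootTwoCount q : ℝ) / (q + 1)) atTop
      (𝓝 (Real.log (1 + 7 * δ / 5) * Real.log (1 + 7 * δ / 6))) := by
  have h1 := tendsto_sum_nu_window (α := 5 / 7) (β := 5 / 7 + δ) (by norm_num) (by linarith)
  have h2 := tendsto_sum_nu_window (α := 6 / 7) (β := 6 / 7 + δ) (by norm_num) (by linarith)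
  rw [show (5 / 7 + δ) / (5 / 7 : ℝ) = 1 + 7 * δ / 5 by field_simp] at h1
  rw [show (6 / 7 + δ) / (6 / 7 : ℝ) = 1 + 7 * δ / 6 by field_simp] at h2
  exact h1.mul h2

end Literature.NumberTheory.Sieve.HeathBrown2001
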